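import Mathlib
import HarnessLib
import Summits.ValiantsHypothesis.ValiantsHypothesis.Theses.MonotoneRestoration
import Summits.ValiantsHypothesis.ValiantsHypothesis.Theorems.MonotoneRestorationOrbitCompressionQPDiCharacterisation
import Literature.Computability.AlgebraicComplexity.PatternExpressions
import Literature.Computability.AlgebraicComplexity.DiPatternExpressions

/-!
# Route MonotoneRestoration — aside `OrbitRestorationLinearVolumeQP` (stmt-ValiantsHypothesis-18294):
# THE CRUX IN ONE-SORTED EXPRESSION CURRENCY (tight re-statement of the open stub)

The registered skeleton of R1 = `OrbitRestorationLinearVolumeQP` (line `birth`, `0500973389fe`) rests on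
ONE open stub, `stub_lvNarrowSpan : LvNarrowSpan` — every `VP` family of the linear-volume class lies, level
by level, in the span of the homomorphism polynomials of BIPARTITE patterns of polylogarithmic treewidth
(`OrbitRestorationLinearVolumeQPNarrow.orbitRestorationLinearVolumeQP_of_lvNarrowSpan`).  That stub is
SUFFICIENT; whether it is NECESSARY is the two-sorted/one-sorted descent question (R1's circuits are only
square-symmetric = diagonally `Sym_n`-symmetric, and the passage "diagonally narrow + matrix-symmetric ⇒
bipartitely narrow" is not in the tree, cf. `Theorems/…OrbitCompressionQPOrbitToNarrowExpressionFalse.lean`).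

This file records the EXACT currency of the crux, using the one-sorted Dawar–Pago–Seppelt characterisation
at quasi-polynomial scale landed for the sibling aside `OrbitCompressionQP`
(`OrbitSupport.qpOrbitFamily_iff_diNarrow`):

* `orbitRestorationLinearVolumeQP_iff_lvDiNarrow` — **R1 holds if and only if every `VP` family of the
  linear-volume class is, from some level on, the closed polynomial of a ONE-SORTED labelled pattern
  expression (`DiPatternExpr`, directed looped patterns) with `k_n` labels, `n^{k_n} ≤ 2^{(log₂ n + c)^c}`,
  of ANY length.**  No loss in either direction: a re-lined skeleton with this statement as its single
  stub is TIGHT (stub ⟺ crux), whereas the registered bipartite stub is a priori stronger.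
* `lvDiNarrow_of_orbitRestorationLinearVolumeQP` / `orbitRestorationLinearVolumeQP_of_lvDiNarrow` — the
  two directions separately (the planner's glue shape).
* `rename_diag_lvExpansion` — square symmetry of the class is automatic (hom combinations are even
  matrix-symmetric, `rename_perm_homPoly`).

Honest label: bookkeeping of currencies (def-free helper, `--supports stmt-ValiantsHypothesis-18294`); the
stub, R1, the parent crux and VP ≠ VNP are NOT moved.  R1 remains VH-strength
(`OrbitRestorationLinearVolumeQPVHStrength.valiantsHypothesis_of_orbitRestorationLinearVolumeQP`).

References: Dwivedi–Pago–Seppelt 2026 (arXiv:2601.09343) eq. (1), Outlook Q3; Dawar–Pago–Seppelt 2025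
(arXiv:2502.06740) Thm 1.1, Remark p. 17, §7 p. 45; Dawar–Wilsenach 2025 §6.
-/

noncomputable section

open scoped Classical

-- `Summit.ValiantsHypothesis.ValiantsHypothesis.…` is the tree's single-conjunct layout (Sub = Summit).
set_option linter.dupNamespace false

namespace Summit.ValiantsHypothesis.ValiantsHypothesis.Theorems.OrbitRestorationLinearVolumeQPDiNarrow

open Literature.Computability.AlgebraicComplexity MvPolynomial
open Summit.ValiantsHypothesis.ValiantsHypothesis.Theorems

/-- **The linear-volume class is square-symmetric**: a combination `Σ_i α_i · hom_{E_i,n}` of bipartite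
homomorphism polynomials is invariant under the diagonal renaming `x_ij ↦ x_{σ i, σ j}` (indeed under
independent row/column permutations, `rename_perm_homPoly`). [folklore] -/
theorem rename_diag_lvExpansion {n m : ℕ} (a b : Fin m → ℕ)
    (E : (i : Fin m) → Multiset (Fin (a i) × Fin (b i))) (α : Fin m → ℂ) (σ : Equiv.Perm (Fin n)) :
    ren σ (∑ i : Fin m, C (α i) * homPoly (E i) n ℂ) = ∑ i : Fin m, C (α i) * homPoly (E i) n ℂ := by
  show rename (fun p : Fin n × Fin n => σ • p) _ = _
  have hfun : (fun p : Fin n × Fin n => σ • p) = fun p : Fin n × Fin n => (σ p.1, σ p.2) := by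
    funext p; rfl
  rw [hfun, map_sum]
  refine Finset.sum_congr rfl fun i _ => ?_
  rw [map_mul, rename_C, rename_perm_homPoly]

/-- **R1 ⟹ one-sorted narrowness.**  If `OrbitRestorationLinearVolumeQP` holds then every `VP` family of the
linear-volume class is, from some `n₀` on, the closed polynomial of a one-sorted labelled pattern
expression with `k` labels, `n^k ≤ 2^{(log₂ n + c)^c}` (support theorem in orbit form + extraction,
`OrbitSupport.qpOrbitFamily_iff_diNarrow`, forward direction). [folklore] -/
theorem lvDiNarrow_of_orbitRestorationLinearVolumeQP
    (h : Summit.ValiantsHypothesis.ValiantsHypothesis.Theses.MonotoneRestoration.OrbitRestorationLinearVolumeQP)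
    (f : (n : ℕ) → MvPolynomial (Fin n × Fin n) ℂ) (hVP : IsVPFamily f)
    (hLV : ∃ (c : ℕ) (m : ℕ → ℕ) (a b : (n : ℕ) → Fin (m n) → ℕ)
        (E : (n : ℕ) → (i : Fin (m n)) → Multiset (Fin (a n i) × Fin (b n i)))
        (α : (n : ℕ) → Fin (m n) → ℂ),
      (∀ n, m n ≤ (n + 2) ^ c) ∧ (∀ n i, a n i + b n i ≤ c * (n + 1)) ∧
        ∀ n, f n = ∑ i : Fin (m n), C (α n i) * homPoly (E n i) n ℂ) :
    ∃ c n₀ : ℕ, ∀ n : ℕ, n₀ ≤ n → ∃ (k : ℕ) (e : DiPatternExpr ℂ k),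
      n ^ k ≤ 2 ^ ((Nat.log 2 n + c) ^ c) ∧ e.close n = f n :=
  ((OrbitSupport.qpOrbitFamily_iff_diNarrow f).1 (h f hVP hLV)).2

/-- **One-sorted narrowness ⟹ R1.**  Conversely, if every `VP` family of the linear-volume class is
eventually the closed polynomial of a one-sorted labelled pattern expression with `n^k ≤ 2^{(log₂ n + c)^c}`
labels (any length), then `OrbitRestorationLinearVolumeQP` holds: square symmetry of the class is
automatic (`rename_diag_lvExpansion`), and `OrbitSupport.qpOrbitFamily_iff_diNarrow` (backward direction:
supported value derivations, value-orbit symmetrisation; small `n` through the orbit circuit) supplies the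
circuits. [folklore] -/
theorem orbitRestorationLinearVolumeQP_of_lvDiNarrow
    (h : ∀ f : (n : ℕ) → MvPolynomial (Fin n × Fin n) ℂ, IsVPFamily f →
      (∃ (c : ℕ) (m : ℕ → ℕ) (a b : (n : ℕ) → Fin (m n) → ℕ)
          (E : (n : ℕ) → (i : Fin (m n)) → Multiset (Fin (a n i) × Fin (b n i)))
          (α : (n : ℕ) → Fin (m n) → ℂ),
        (∀ n, m n ≤ (n + 2) ^ c) ∧ (∀ n i, a n i + b n i ≤ c * (n + 1)) ∧
          ∀ n, f n = ∑ i : Fin (m n), C (α n i) * homPoly (E n i) n ℂ) →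
      ∃ c n₀ : ℕ, ∀ n : ℕ, n₀ ≤ n → ∃ (k : ℕ) (e : DiPatternExpr ℂ k),
        n ^ k ≤ 2 ^ ((Nat.log 2 n + c) ^ c) ∧ e.close n = f n) :
    Summit.ValiantsHypothesis.ValiantsHypothesis.Theses.MonotoneRestoration.OrbitRestorationLinearVolumeQP := by
  intro f hVP hLV
  refine (OrbitSupport.qpOrbitFamily_iff_diNarrow f).2 ⟨fun n σ => ?_, h f hVP hLV⟩
  obtain ⟨c, m, a, b, E, α, -, -, hf⟩ := hLV
  rw [hf n]
  exact rename_diag_lvExpansion (a n) (b n) (E n) (α n) σ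

/-- **THE CRUX IN ONE-SORTED EXPRESSION CURRENCY (tight).**  `OrbitRestorationLinearVolumeQP` holds if and
only if every `VP` family of the linear-volume class (level by level a combination of `≤ (n+2)^c`
homomorphism polynomials of bipartite patterns with `≤ c (n+1)` vertices) is, from some level on, the
closed polynomial of a ONE-SORTED labelled pattern expression over `ℂ` with `k` labels,
`n^k ≤ 2^{(log₂ n + c')^c'}`, of any length.  (So a skeleton with this statement as its only stub closes R1
with no loss; the registered bipartite-span stub `LvNarrowSpan` implies it.) [folklore] -/
theorem orbitRestorationLinearVolumeQP_iff_lvDiNarrow :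
    Summit.ValiantsHypothesis.ValiantsHypothesis.Theses.MonotoneRestoration.OrbitRestorationLinearVolumeQP ↔
    ∀ f : (n : ℕ) → MvPolynomial (Fin n × Fin n) ℂ, IsVPFamily f →
      (∃ (c : ℕ) (m : ℕ → ℕ) (a b : (n : ℕ) → Fin (m n) → ℕ)
          (E : (n : ℕ) → (i : Fin (m n)) → Multiset (Fin (a n i) × Fin (b n i)))
          (α : (n : ℕ) → Fin (m n) → ℂ),
        (∀ n, m n ≤ (n + 2) ^ c) ∧ (∀ n i, a n i + b n i ≤ c * (n + 1)) ∧
          ∀ n, f n = ∑ i : Fin (m n), C (α n i) * homPoly (E n i) n ℂ) →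
      ∃ c n₀ : ℕ, ∀ n : ℕ, n₀ ≤ n → ∃ (k : ℕ) (e : DiPatternExpr ℂ k),
        n ^ k ≤ 2 ^ ((Nat.log 2 n + c) ^ c) ∧ e.close n = f n :=
  ⟨fun h f hVP hLV => lvDiNarrow_of_orbitRestorationLinearVolumeQP h f hVP hLV,
    orbitRestorationLinearVolumeQP_of_lvDiNarrow⟩

end Summit.ValiantsHypothesis.ValiantsHypothesis.Theorems.OrbitRestorationLinearVolumeQPDiNarrow

end
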